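import Literature.Probability.RandomPlanarGeometry.SAWWordsZd
import HarnessLib

/-!
# THE SINGLETON-AXIS RENEWAL IDENTITY: `c_n(ℤ^d)` in every dimension from the shorter counts and the walks WITHOUT an axis used exactly once

Topic `Literature/Probability/RandomPlanarGeometry` (sequel of `SAWWordsZd.lean`: step words `List (Fin d × Bool)`, `Word.IsSAW`, `Word.sawWords`,
`Word.card_sawWords : #sawWords d n = c_n(ℤ^d) = SAW.Zd.count d n`).

PRINTED CONTEXT (locators only; nothing is quoted digit-for-digit). Madras–Slade (1993) §1.1 (the counts `c_n`), Definition 1.1.1 (self-avoiding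
walk). Clisby–Liang–Slade (2007) §3.3, eq. (31) and the paragraph after it (p. 10984): "enumeration of `c_n` for `n ≤ 2k` and `d ≤ k` actually
gives the enumeration of `c_n` for `n ≤ 2k` in all dimensions" — THERE via the lace expansion (the lace-graph counts `π_{m,δ}` vanish for `δ > m/2`).
NOT IN PRINT as far as the lane's search found (a-p3 g23 presearch 2026-08-27: corpus hybrid + galaxy; CLS 2007 §3.3 read): the elementary identity
below, which reaches the same "all dimensions from `≤ n/2` axes" conclusion WITHOUT the lace expansion.

THE IDENTITY. Call an axis of a step word a SINGLETON axis if exactly one letter lies on it, and let `A_n(d) = #nsWords d n` be the number of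
`n`-step self-avoiding walks of `ℤ^d` with NO singleton axis (such a walk uses at most `⌊n/2⌋` axes). Then for every `d` and `n`
(★★★ `card_nsWords_eq_sum`, ★★★ `count_eq_card_nsWords_add_sum`):

  `c_n(ℤ^d) = A_n(d) + Σ_{r=1}^{n} (−1)^{r+1} · 2^r · d(d−1)⋯(d−r+1) · Σ_{ℓ₀+ℓ₁+⋯+ℓ_r = n−r} Π_{j=0}^{r} c_{ℓ_j}(ℤ^{d−r})`.

So `c_n(ℤ^d)` for ALL `d` follows from the `c_ℓ(ℤ^{d'})`, `ℓ < n`, and ONE census over words on `≤ n/2` axes (e.g. `c_{11}(ℤ^d)` from the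
≈ 3·10⁶ canonical no-singleton words instead of the ≈ 1.5·10⁷ canonical self-avoiding words of the lane's (11,12) cell).

MECHANISM (all proved here, standard axioms).
* §1 ★ DECOUPLING `isSAW_append_cons_iff`: if the axis of `e` occurs neither in `u` nor in `v`, then `u ++ e :: v` is self-avoiding iff `u`
  and `v` are (the sites of `u` have `e.1`-coordinate `0`, those after `e` have `±1`).
* §2–§3 MARKED WORDS (`glueR` / `split`, a bijection: `split_glueR`, `glueR_split`): a marked word is VALID (`ValidM`) if its underlying word
  is self-avoiding and every marked letter lies on a singleton axis; ★★ `validM_glueR_iff`: validity of `g₀ e₁ g₁ ⋯ e_r g_r` (marks `e_i`)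
  ⟺ every block `g_j` self-avoiding, the `e_i` on pairwise distinct axes, and no block touching a marked axis (`AdmF`) — decoupling mark by mark.
* §4 ★★ `sum_validWords_neg_one_pow`: `Σ_{valid marked words of length n} (−1)^{#marks} = A_n(d)` — toggling the mark on the first
  singleton-axis letter (`tog`) is a sign-reversing involution off the no-singleton words (`Finset.sum_involution`).
* §5 RELABELLING ★ `card_sawWords_filter_axes`: the self-avoiding words of length `ℓ` on the axes of a set `C` number `c_ℓ(ℤ^{#C})`
  (the coordinate embedding `embC`, `isSAW_map_relab_iff`).
* §6 ★★★ `card_validWords_filter_nmarks`: the valid marked words of length `s + r` with `r` marks number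
  `2^r d^{(r)} Σ_{ℓ₀+⋯+ℓ_r = s} Π_j c_{ℓ_j}(ℤ^{d−r})` (`assemble` is a bijection from (marks on distinct axes `markFns`, `card_markFns`;
  block families in `blockSet`, `card_blockSet`) onto them: `validM_assemble_iff`, `assemble_injective`).
* §7 the identity: sum §6 against the signs of §4, the `r = 0` term being `c_n(ℤ^d)` (`blockSum_zero`).
The definitions `axCount`, `base`, `nmarks`, `glueR`, `split`, `ValidM`, `AdmF`, `NoSingleton`, `nsWords`, `mwords`, `validWords`, `tog`, `embC`,
`relab`, `markFns`, `blockSet`, `assemble`, `blockSum` are this file's tool notions (not notions in print). No number is taken from print.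
[cite: MadrasSlade1993, §1.1; Definition 1.1.1] [cite: ClisbyLiangSlade2007, §3.3 eq. (31)]

Provenance: lane «pcv-sawmu», a-p3 g23 (2026-08-27).
-/

open Finset Literature.Probability.LatticeModels Literature.Probability.Percolation
open scoped BigOperators

namespace Literature.Probability.RandomPlanarGeometry.SAW.Zd

namespace Word

variable {d : ℕ}

/-! ### §1 Axis counts and the decoupling lemma -/

/-- The number of letters of `w` on axis `a`. [cite: MadrasSlade1993, Definition 1.1.1] -/
def axCount (w : List (Fin d × Bool)) (a : Fin d) : ℕ := w.countP fun x => x.1 = a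

/-- `axCount` of a concatenation. [cite: MadrasSlade1993, Definition 1.1.1] -/
@[simp] theorem axCount_append (u v : List (Fin d × Bool)) (a : Fin d) : axCount (u ++ v) a = axCount u a + axCount v a := by
  simp [axCount, List.countP_append]

/-- `axCount` of a cons. [cite: MadrasSlade1993, Definition 1.1.1] -/
@[simp] theorem axCount_cons (x : Fin d × Bool) (v : List (Fin d × Bool)) (a : Fin d) :
    axCount (x :: v) a = axCount v a + (if x.1 = a then 1 else 0) := by
  simp [axCount, List.countP_cons]

/-- `axCount [] = 0`. [cite: MadrasSlade1993, Definition 1.1.1] -/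
@[simp] theorem axCount_nil (a : Fin d) : axCount ([] : List (Fin d × Bool)) a = 0 := rfl

/-- `axCount w a = 0` iff no letter of `w` lies on axis `a`. [cite: MadrasSlade1993, Definition 1.1.1] -/
theorem axCount_eq_zero_iff (w : List (Fin d × Bool)) (a : Fin d) : axCount w a = 0 ↔ ∀ x ∈ w, x.1 ≠ a := by
  simp [axCount, List.countP_eq_zero]

/-- Coordinates of a unit step. [cite: MadrasSlade1993, §1.1] -/
theorem stepVec_apply' (x : Fin d × Bool) (a : Fin d) : stepVec x a = if a = x.1 then (if x.2 then 1 else -1) else 0 := by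
  unfold stepVec
  by_cases h : a = x.1
  · subst h; cases x.2 <;> simp
  · cases x.2 <;> simp [h]

/-- A word without letters on axis `a` ends on the hyperplane `x_a = 0`. [cite: MadrasSlade1993, §1.1] -/
theorem wEnd_apply_eq_zero {w : List (Fin d × Bool)} {a : Fin d} (h : axCount w a = 0) : wEnd w a = 0 := by
  induction w with
  | nil => simp
  | cons x w ih =>
    rw [axCount_cons] at h
    have hx : x.1 ≠ a := by intro e; simp [e] at h
    have hw : axCount w a = 0 := by
      by_cases e : x.1 = a
      · simp [e] at h
      · simpa [e] using h
    rw [wEnd_cons, Pi.add_apply, ih hw, stepVec_apply', if_neg (Ne.symm hx)]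
    simp

/-- … and so does every prefix: the whole trajectory stays on `x_a = 0`. [cite: MadrasSlade1993, §1.1] -/
theorem traj_apply_eq_zero {w : List (Fin d × Bool)} {a : Fin d} (h : axCount w a = 0) (i : ℕ) : traj w i a = 0 := by
  apply wEnd_apply_eq_zero
  have h2 : (List.take i w).countP (fun x => x.1 = a) ≤ w.countP (fun x => x.1 = a) := (List.take_sublist i w).countP_le
  unfold axCount at h ⊢
  omega

/-- ★ DECOUPLING: if the axis of the letter `e` occurs neither in `u` nor in `v`, then `u ++ e :: v` is self-avoiding iff
`u` and `v` are — the sites of `u` lie on `x_{e.1} = 0`, those after `e` on `x_{e.1} = ±1`. [cite: MadrasSlade1993, §1.1] -/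
theorem isSAW_append_cons_iff (u v : List (Fin d × Bool)) (e : Fin d × Bool) (hu : axCount u e.1 = 0)
    (hv : axCount v e.1 = 0) : IsSAW (u ++ e :: v) ↔ IsSAW u ∧ IsSAW v := by
  constructor
  · intro h
    refine ⟨?_, ?_⟩
    · have := h.take u.length
      rwa [List.take_left'] at this
      rfl
    · have := h.drop (u.length + 1)
      rwa [show u ++ e :: v = (u ++ [e]) ++ v by simp, List.drop_left'] at this
      simp
  · rintro ⟨h1, h2⟩
    rw [isSAW_iff_injOn] at h1 h2 ⊢
    have hlen : (u ++ e :: v).length = u.length + 1 + v.length := by simp; omega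
    -- positions in the `v` part
    have key : ∀ m, traj (u ++ e :: v) (u.length + 1 + m) = wEnd u + stepVec e + traj v m := fun m => by
      have := traj_append_right (u ++ [e]) v m
      simp only [List.append_assoc, List.singleton_append, List.length_append, List.length_singleton, wEnd_append,
        wEnd_singleton] at this
      exact this
    have hcoordL : ∀ i, i ≤ u.length → traj (u ++ e :: v) i e.1 = 0 := fun i hi => by
      rw [traj_append_left _ _ hi]; exact traj_apply_eq_zero hu i
    have hcoordR : ∀ m, traj (u ++ e :: v) (u.length + 1 + m) e.1 ≠ 0 := fun m => by
      rw [key, Pi.add_apply, Pi.add_apply, wEnd_apply_eq_zero hu, traj_apply_eq_zero hv, stepVec_apply', if_pos rfl]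
      cases e.2 <;> simp
    intro i hi j hj hij
    simp only [Set.mem_setOf_eq, hlen] at hi hj
    rcases le_or_gt i u.length with hiu | hiu <;> rcases le_or_gt j u.length with hju | hju
    · rw [traj_append_left _ _ hiu, traj_append_left _ _ hju] at hij
      exact h1 (by simpa using hiu) (by simpa using hju) hij
    · exfalso
      obtain ⟨m, rfl⟩ : ∃ m, j = u.length + 1 + m := ⟨j - (u.length + 1), by omega⟩
      have := congrFun hij e.1
      rw [hcoordL i hiu] at this
      exact hcoordR m this.symm
    · exfalso
      obtain ⟨m, rfl⟩ : ∃ m, i = u.length + 1 + m := ⟨i - (u.length + 1), by omega⟩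
      have := congrFun hij e.1
      rw [hcoordL j hju] at this
      exact hcoordR m this
    · obtain ⟨m, rfl⟩ : ∃ m, i = u.length + 1 + m := ⟨i - (u.length + 1), by omega⟩
      obtain ⟨m', rfl⟩ : ∃ m', j = u.length + 1 + m' := ⟨j - (u.length + 1), by omega⟩
      rw [key, key] at hij
      have := h2 (show m ∈ {i | i ≤ v.length} by simp; omega) (show m' ∈ {i | i ≤ v.length} by simp; omega)
        (add_left_cancel hij)
      rw [this]


/-! ### §2 Marked words: a step word some of whose letters carry a mark -/

/-- The underlying step word of a marked word (forget the marks). [cite: MadrasSlade1993, Definition 1.1.1] -/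
def base (m : List ((Fin d × Bool) × Bool)) : List (Fin d × Bool) := m.map Prod.fst

/-- The number of marked letters. [cite: MadrasSlade1993, Definition 1.1.1] -/
def nmarks (m : List ((Fin d × Bool) × Bool)) : ℕ := m.countP fun x => x.2

/-- GLUE: the marked word with first block `g₀` and then, for each `(e, g)` in `rest`, the MARKED letter `e` followed by the unmarked
block `g`. [cite: MadrasSlade1993, Definition 1.1.1] -/
def glueR (g₀ : List (Fin d × Bool)) (rest : List ((Fin d × Bool) × List (Fin d × Bool))) : List ((Fin d × Bool) × Bool) :=
  g₀.map (fun x => (x, false)) ++ rest.flatMap fun p => (p.1, true) :: p.2.map fun x => (x, false)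

/-- SPLIT a marked word at its marked letters: the first block and the list of (marked letter, following block).
[cite: MadrasSlade1993, Definition 1.1.1] -/
def split : List ((Fin d × Bool) × Bool) → List (Fin d × Bool) × List ((Fin d × Bool) × List (Fin d × Bool))
  | [] => ([], [])
  | (x, false) :: m => (x :: (split m).1, (split m).2)
  | (x, true) :: m => ([], (x, (split m).1) :: (split m).2)

/-- `glueR` with a nonempty first block. [cite: MadrasSlade1993, Definition 1.1.1] -/
theorem glueR_cons (x : Fin d × Bool) (g₀ : List (Fin d × Bool)) (rest : List ((Fin d × Bool) × List (Fin d × Bool))) :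
    glueR (x :: g₀) rest = (x, false) :: glueR g₀ rest := rfl

/-- `glueR` with an empty first block and a first mark. [cite: MadrasSlade1993, Definition 1.1.1] -/
theorem glueR_nil_cons (e : Fin d × Bool) (g : List (Fin d × Bool)) (rest : List ((Fin d × Bool) × List (Fin d × Bool))) :
    glueR [] ((e, g) :: rest) = (e, true) :: glueR g rest := by
  simp [glueR]

/-- `split ∘ glue = id`. [cite: MadrasSlade1993, Definition 1.1.1] -/
theorem split_glueR : ∀ (rest : List ((Fin d × Bool) × List (Fin d × Bool))) (g₀ : List (Fin d × Bool)),
    split (glueR g₀ rest) = (g₀, rest) := by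
  intro rest
  induction rest with
  | nil =>
    intro g₀
    induction g₀ with
    | nil => rfl
    | cons x g₀ ih => rw [glueR_cons, split, ih]
  | cons p rest ihr =>
    intro g₀
    induction g₀ with
    | nil => obtain ⟨e, g⟩ := p; rw [glueR_nil_cons, split, ihr]
    | cons x g₀ ih => rw [glueR_cons, split, ih]

/-- `glue ∘ split = id`. [cite: MadrasSlade1993, Definition 1.1.1] -/
theorem glueR_split : ∀ m : List ((Fin d × Bool) × Bool), glueR (split m).1 (split m).2 = m := by
  intro m
  induction m with
  | nil => rfl
  | cons x m ih =>
    obtain ⟨x, b⟩ := x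
    cases b
    · rw [split, glueR_cons, ih]
    · rw [split, glueR_nil_cons, ih]

/-- The underlying word of a glued marked word. [cite: MadrasSlade1993, Definition 1.1.1] -/
theorem base_glueR (g₀ : List (Fin d × Bool)) (rest : List ((Fin d × Bool) × List (Fin d × Bool))) :
    base (glueR g₀ rest) = g₀ ++ rest.flatMap fun p => p.1 :: p.2 := by
  simp [base, glueR, List.map_flatMap, Function.comp_def]

/-- `glueR` unfolded at the first (mark, block) pair. [cite: MadrasSlade1993, Definition 1.1.1] -/
theorem glueR_cons_pair (g₀ : List (Fin d × Bool)) (p : (Fin d × Bool) × List (Fin d × Bool))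
    (rest : List ((Fin d × Bool) × List (Fin d × Bool))) :
    glueR g₀ (p :: rest) = g₀.map (fun x => (x, false)) ++ (p.1, true) :: glueR p.2 rest := by
  simp [glueR]

/-- An unmarked block carries no mark. [cite: MadrasSlade1993, Definition 1.1.1] -/
theorem nmarks_map_unmarked (g : List (Fin d × Bool)) : nmarks (g.map fun x => (x, false)) = 0 := by
  simp [nmarks, List.countP_map, Function.comp_def]

/-- `nmarks` of a concatenation. [cite: MadrasSlade1993, Definition 1.1.1] -/
theorem nmarks_append (m m' : List ((Fin d × Bool) × Bool)) : nmarks (m ++ m') = nmarks m + nmarks m' := by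
  simp [nmarks, List.countP_append]

/-- The number of marks of a glued marked word is the number of (mark, block) pairs. [cite: MadrasSlade1993, Definition 1.1.1] -/
theorem nmarks_glueR (g₀ : List (Fin d × Bool)) (rest : List ((Fin d × Bool) × List (Fin d × Bool))) :
    nmarks (glueR g₀ rest) = rest.length := by
  induction rest generalizing g₀ with
  | nil => simpa [glueR] using nmarks_map_unmarked g₀
  | cons p rest ih =>
    rw [glueR_cons_pair, nmarks_append, nmarks_map_unmarked, nmarks, List.countP_cons, ← nmarks, ih p.2]
    simp

/-- The length of a glued marked word. [cite: MadrasSlade1993, Definition 1.1.1] -/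
theorem length_glueR (g₀ : List (Fin d × Bool)) (rest : List ((Fin d × Bool) × List (Fin d × Bool))) :
    (glueR g₀ rest).length = g₀.length + (rest.map fun p => p.2.length + 1).sum := by
  induction rest generalizing g₀ with
  | nil => simp [glueR]
  | cons p rest ih =>
    rw [glueR_cons_pair, List.length_append, List.length_map, List.length_cons, ih p.2]
    simp only [List.map_cons, List.sum_cons]
    omega

/-! ### §3 Valid marked words: the marks sit on singleton axes of a self-avoiding word -/

/-- A marked word is VALID if its underlying word is self-avoiding and every marked letter lies on an axis used exactly once.
[cite: MadrasSlade1993, Definition 1.1.1] -/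
def ValidM (m : List ((Fin d × Bool) × Bool)) : Prop := IsSAW (base m) ∧ ∀ x ∈ m, x.2 = true → axCount (base m) x.1.1 = 1

/-- ADMISSIBLE glue data: every block self-avoiding, the marked letters on pairwise distinct axes, and no block touches a marked axis.
[cite: MadrasSlade1993, Definition 1.1.1] -/
def AdmF (g₀ : List (Fin d × Bool)) (rest : List ((Fin d × Bool) × List (Fin d × Bool))) : Prop :=
  (IsSAW g₀ ∧ ∀ p ∈ rest, IsSAW p.2) ∧ (rest.map fun p => p.1.1).Nodup ∧
    ∀ p ∈ rest, axCount g₀ p.1.1 = 0 ∧ ∀ q ∈ rest, axCount q.2 p.1.1 = 0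

/-- Axis count of a word flattened from blocks and separators vanishes iff it vanishes on every piece. [cite: MadrasSlade1993, Definition 1.1.1] -/
theorem axCount_flat_eq_zero_iff (g : List (Fin d × Bool)) (rest : List ((Fin d × Bool) × List (Fin d × Bool))) (a : Fin d) :
    axCount (g ++ rest.flatMap fun p => p.1 :: p.2) a = 0 ↔ axCount g a = 0 ∧ ∀ q ∈ rest, q.1.1 ≠ a ∧ axCount q.2 a = 0 := by
  simp only [axCount_eq_zero_iff, List.mem_append, List.mem_flatMap, List.mem_cons]
  constructor
  · intro h
    exact ⟨fun x hx => h x (Or.inl hx), fun q hq => ⟨h q.1 (Or.inr ⟨q, hq, Or.inl rfl⟩), fun x hx => h x (Or.inr ⟨q, hq, Or.inr hx⟩)⟩⟩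
  · rintro ⟨h1, h2⟩ x (hx | ⟨q, hq, rfl | hx⟩)
    · exact h1 x hx
    · exact (h2 q hq).1
    · exact (h2 q hq).2 x hx

/-- The marked letters of `glueR g rest` are the first components of `rest`. [cite: MadrasSlade1993, Definition 1.1.1] -/
theorem mem_marked_glueR_iff (g : List (Fin d × Bool)) (rest : List ((Fin d × Bool) × List (Fin d × Bool))) (x : Fin d × Bool) :
    (x, true) ∈ glueR g rest ↔ x ∈ rest.map Prod.fst := by
  simp [glueR]

/-- A letter of a word contributes to its axis count. [cite: MadrasSlade1993, Definition 1.1.1] -/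
theorem one_le_axCount_of_mem {w : List (Fin d × Bool)} {x : Fin d × Bool} (hx : x ∈ w) : 1 ≤ axCount w x.1 :=
  List.countP_pos_iff.2 ⟨x, hx, by simp⟩

/-- `axCount` of `u ++ e :: v`. [cite: MadrasSlade1993, Definition 1.1.1] -/
theorem axCount_append_cons (u v : List (Fin d × Bool)) (e : Fin d × Bool) (a : Fin d) :
    axCount (u ++ e :: v) a = axCount u a + axCount v a + (if e.1 = a then 1 else 0) := by
  rw [axCount_append, axCount_cons]; ring

/-- ★★ VALIDITY OF A GLUED WORD IS ADMISSIBILITY OF ITS DATA (by the decoupling lemma, mark by mark).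
[cite: MadrasSlade1993, Definition 1.1.1] -/
theorem validM_glueR_iff : ∀ (rest : List ((Fin d × Bool) × List (Fin d × Bool))) (g₀ : List (Fin d × Bool)),
    ValidM (glueR g₀ rest) ↔ AdmF g₀ rest := by
  intro rest
  induction rest with
  | nil =>
    intro g₀
    simp [ValidM, AdmF, glueR, base, Function.comp_def]
  | cons p rest ih =>
    intro g₀
    obtain ⟨e, g⟩ := p
    have hB : base (glueR g₀ ((e, g) :: rest)) = g₀ ++ e :: base (glueR g rest) := by
      rw [base_glueR, base_glueR, List.flatMap_cons]; simp
    set B := base (glueR g rest) with hBdef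
    have hBflat : B = g ++ rest.flatMap fun p => p.1 :: p.2 := base_glueR g rest
    -- marks of the whole word
    have hmarks : ∀ y : (Fin d × Bool) × Bool, y ∈ glueR g₀ ((e, g) :: rest) ∧ y.2 = true ↔
        y = (e, true) ∨ (y.2 = true ∧ (y.1, true) ∈ glueR g rest) := by
      intro y
      obtain ⟨y, b⟩ := y
      cases b
      · simp
      · simp only [glueR_cons_pair, List.mem_append, List.mem_map, Prod.mk.injEq, Bool.false_eq_true, and_false,
          exists_false, List.mem_cons, and_true, false_or, true_and]
    constructor
    · rintro ⟨hsaw, hmk⟩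
      rw [hB] at hsaw hmk
      have he : axCount g₀ e.1 = 0 ∧ axCount B e.1 = 0 := by
        have := hmk (e, true) (by rw [glueR_cons_pair]; simp) rfl
        dsimp only at this
        rw [axCount_append_cons, if_pos rfl] at this
        constructor <;> omega
      rw [isSAW_append_cons_iff _ _ _ he.1 he.2] at hsaw
      have hinner : ∀ x : Fin d × Bool, (x, true) ∈ glueR g rest → axCount B x.1 = 1 ∧ axCount g₀ x.1 = 0 ∧ e.1 ≠ x.1 := by
        intro x hx
        have h1 := hmk (x, true) (by rw [glueR_cons_pair]; simp [hx]) rfl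
        dsimp only at h1
        rw [axCount_append_cons] at h1
        have h2 : 1 ≤ axCount B x.1 := one_le_axCount_of_mem (w := B) (by
          rw [hBdef, base]; exact List.mem_map.2 ⟨(x, true), hx, rfl⟩)
        by_cases hex : e.1 = x.1
        · rw [if_pos hex] at h1; omega
        · rw [if_neg hex] at h1; exact ⟨by omega, by omega, hex⟩
      have hV : ValidM (glueR g rest) := ⟨hsaw.2, fun y hy hy2 => by
        obtain ⟨y, b⟩ := y; cases b
        · simp at hy2
        · exact (hinner y hy).1⟩
      have hA := (ih g).1 hV
      obtain ⟨⟨hg, hblocks⟩, hnd, hax⟩ := hA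
      have hBz := (axCount_flat_eq_zero_iff g rest e.1).1 (hBflat ▸ he.2)
      refine ⟨⟨hsaw.1, ?_⟩, ?_, ?_⟩
      · intro q hq
        rcases List.mem_cons.1 hq with rfl | hq
        · exact hg
        · exact hblocks q hq
      · rw [List.map_cons, List.nodup_cons]
        refine ⟨fun hmem => ?_, hnd⟩
        obtain ⟨q, hq, hqe⟩ := List.mem_map.1 hmem
        exact (hBz.2 q hq).1 hqe
      · intro q hq
        rcases List.mem_cons.1 hq with rfl | hq
        · refine ⟨he.1, ?_⟩
          intro q' hq'
          rcases List.mem_cons.1 hq' with rfl | hq'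
          · exact hBz.1
          · exact (hBz.2 q' hq').2
        · have hxq := hinner q.1 ((mem_marked_glueR_iff g rest q.1).2 (List.mem_map.2 ⟨q, hq, rfl⟩))
          refine ⟨hxq.2.1, ?_⟩
          intro q' hq'
          rcases List.mem_cons.1 hq' with rfl | hq'
          · exact (hax q hq).1
          · exact (hax q hq).2 q' hq'
    · rintro ⟨⟨hg₀, hbl⟩, hnd, hax⟩
      rw [List.map_cons, List.nodup_cons] at hnd
      have hAin : AdmF g rest := ⟨⟨hbl (e, g) (by simp), fun q hq => hbl q (by simp [hq])⟩, hnd.2,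
        fun q hq => ⟨(hax q (by simp [hq])).2 (e, g) (by simp), fun q' hq' => (hax q (by simp [hq])).2 q' (by simp [hq'])⟩⟩
      have hV := (ih g).2 hAin
      have he0 : axCount g₀ e.1 = 0 := (hax (e, g) (by simp)).1
      have hBe : axCount B e.1 = 0 := by
        rw [hBflat, axCount_flat_eq_zero_iff]
        refine ⟨(hax (e, g) (by simp)).2 (e, g) (by simp), fun q hq => ⟨fun hqe => hnd.1 ?_, (hax (e, g) (by simp)).2 q (by simp [hq])⟩⟩
        exact List.mem_map.2 ⟨q, hq, hqe⟩
      refine ⟨?_, ?_⟩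
      · rw [hB, isSAW_append_cons_iff _ _ _ he0 hBe]; exact ⟨hg₀, hV.1⟩
      · intro y hy hy2
        rw [hB, axCount_append_cons]
        rcases (hmarks y).1 ⟨hy, hy2⟩ with rfl | ⟨-, hyin⟩
        · rw [if_pos rfl, he0, hBe]
        · have h1 : axCount B y.1.1 = 1 := hV.2 (y.1, true) hyin rfl
          obtain ⟨q, hq, hqy⟩ := List.mem_map.1 ((mem_marked_glueR_iff g rest y.1).1 hyin)
          have h2 : axCount g₀ y.1.1 = 0 := by rw [← hqy]; exact (hax q (by simp [hq])).1
          have h3 : e.1 ≠ y.1.1 := by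
            intro hex; apply hnd.1; rw [hex, ← hqy]; exact List.mem_map.2 ⟨q, hq, rfl⟩
          rw [h1, h2, if_neg h3]

/-! ### §4 The signed count of valid marked words is the number of self-avoiding words WITHOUT a singleton axis -/

/-- A word has NO SINGLETON AXIS: no axis carries exactly one of its letters. [cite: MadrasSlade1993, Definition 1.1.1] -/
def NoSingleton (w : List (Fin d × Bool)) : Prop := ∀ a : Fin d, axCount w a ≠ 1

open Classical in
/-- The self-avoiding words of length `n` without a singleton axis. [cite: MadrasSlade1993, Definition 1.1.1] -/
noncomputable def nsWords (d n : ℕ) : Finset (List (Fin d × Bool)) := (sawWords d n).filter NoSingleton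

/-- All marked words of length `n`. [cite: MadrasSlade1993, Definition 1.1.1] -/
def mwords (d n : ℕ) : Finset (List ((Fin d × Bool) × Bool)) :=
  (Finset.univ : Finset (Fin n → (Fin d × Bool) × Bool)).image List.ofFn

/-- Membership in `mwords d n` is having length `n`. [cite: MadrasSlade1993, Definition 1.1.1] -/
@[simp] theorem mem_mwords {n : ℕ} {m : List ((Fin d × Bool) × Bool)} : m ∈ mwords d n ↔ m.length = n := by
  simp only [mwords, Finset.mem_image, Finset.mem_univ, true_and]
  constructor
  · rintro ⟨f, rfl⟩; simp
  · intro h; subst h; exact ⟨fun i => m[i], List.ofFn_getElem⟩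

open Classical in
/-- The valid marked words of length `n`. [cite: MadrasSlade1993, Definition 1.1.1] -/
noncomputable def validWords (d n : ℕ) : Finset (List ((Fin d × Bool) × Bool)) := (mwords d n).filter ValidM

/-- TOGGLE the mark of the first letter whose axis is a singleton axis of `w`. [cite: MadrasSlade1993, Definition 1.1.1] -/
def tog (w : List (Fin d × Bool)) : List ((Fin d × Bool) × Bool) → List ((Fin d × Bool) × Bool)
  | [] => []
  | x :: m => if axCount w x.1.1 = 1 then (x.1, !x.2) :: m else x :: tog w m

/-- `tog` does not change the underlying word. [cite: MadrasSlade1993, Definition 1.1.1] -/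
theorem base_tog (w : List (Fin d × Bool)) : ∀ m : List ((Fin d × Bool) × Bool), base (tog w m) = base m := by
  intro m
  induction m with
  | nil => rfl
  | cons x m ih =>
    rw [tog]
    split_ifs
    · rfl
    · simp only [base, List.map_cons] at ih ⊢; rw [ih]

/-- `tog` does not change the length. [cite: MadrasSlade1993, Definition 1.1.1] -/
theorem length_tog (w : List (Fin d × Bool)) (m : List ((Fin d × Bool) × Bool)) : (tog w m).length = m.length := by
  have := congrArg List.length (base_tog w m)
  simpa [base] using this

/-- `tog` is an involution. [cite: MadrasSlade1993, Definition 1.1.1] -/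
theorem tog_tog (w : List (Fin d × Bool)) : ∀ m : List ((Fin d × Bool) × Bool), tog w (tog w m) = m := by
  intro m
  induction m with
  | nil => rfl
  | cons x m ih =>
    rw [tog]
    split_ifs with h
    · rw [tog, if_pos h]; simp
    · rw [tog, if_neg h, ih]

/-- If some letter of `m` lies on a singleton axis of `w`, `tog` changes the number of marks by one. [cite: MadrasSlade1993, Definition 1.1.1] -/
theorem nmarks_tog (w : List (Fin d × Bool)) : ∀ m : List ((Fin d × Bool) × Bool), (∃ x ∈ m, axCount w x.1.1 = 1) →
    nmarks (tog w m) = nmarks m + 1 ∨ nmarks m = nmarks (tog w m) + 1 := by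
  intro m
  induction m with
  | nil => intro h; simp at h
  | cons x m ih =>
    intro h
    rw [tog]
    split_ifs with hx
    · obtain ⟨x, b⟩ := x
      cases b <;> simp [nmarks]
    · obtain ⟨y, hy, hy1⟩ := h
      rcases List.mem_cons.1 hy with rfl | hy
      · exact absurd hy1 hx
      · have := ih ⟨y, hy, hy1⟩
        simp only [nmarks, List.countP_cons] at this ⊢
        omega

/-- The marks of `tog w m` on letters NOT toggled are those of `m`; the toggled letter lies on a singleton axis.
[cite: MadrasSlade1993, Definition 1.1.1] -/
theorem mem_tog (w : List (Fin d × Bool)) : ∀ (m : List ((Fin d × Bool) × Bool)) (y : (Fin d × Bool) × Bool),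
    y ∈ tog w m → y ∈ m ∨ axCount w y.1.1 = 1 := by
  intro m
  induction m with
  | nil => intro y h; simp [tog] at h
  | cons x m ih =>
    intro y h
    rw [tog] at h
    split_ifs at h with hx
    · rcases List.mem_cons.1 h with rfl | h
      · exact Or.inr hx
      · exact Or.inl (List.mem_cons_of_mem _ h)
    · rcases List.mem_cons.1 h with rfl | h
      · exact Or.inl List.mem_cons_self
      · rcases ih y h with h' | h'
        · exact Or.inl (List.mem_cons_of_mem _ h')
        · exact Or.inr h'

/-- `tog (base m)` preserves validity. [cite: MadrasSlade1993, Definition 1.1.1] -/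
theorem validM_tog {m : List ((Fin d × Bool) × Bool)} (h : ValidM m) : ValidM (tog (base m) m) := by
  refine ⟨by rw [base_tog]; exact h.1, fun y hy hy2 => ?_⟩
  rw [base_tog]
  rcases mem_tog (base m) m y hy with h' | h'
  · exact h.2 y h' hy2
  · exact h'

/-- A valid marked word over a word without singleton axes carries no mark. [cite: MadrasSlade1993, Definition 1.1.1] -/
theorem nmarks_eq_zero_of_noSingleton {m : List ((Fin d × Bool) × Bool)} (h : ValidM m) (hns : NoSingleton (base m)) :
    nmarks m = 0 := by
  rw [nmarks, List.countP_eq_zero]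
  intro y hy hy2
  exact hns y.1.1 (h.2 y hy hy2)

/-- A marked word without marks is its underlying word, unmarked. [cite: MadrasSlade1993, Definition 1.1.1] -/
theorem eq_map_base_of_nmarks_eq_zero : ∀ {m : List ((Fin d × Bool) × Bool)}, nmarks m = 0 →
    m = (base m).map fun x => (x, false) := by
  intro m
  induction m with
  | nil => intro; rfl
  | cons x m ih =>
    intro h
    obtain ⟨x, b⟩ := x
    simp only [nmarks, List.countP_cons] at h
    cases b
    · simp only [Bool.false_eq_true, ↓reduceIte, add_zero] at h
      rw [base, List.map_cons, List.map_cons, ← base, ← ih h]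
    · simp at h

/-- A word with a singleton axis has a letter on a singleton axis. [cite: MadrasSlade1993, Definition 1.1.1] -/
theorem exists_mem_singleton {m : List ((Fin d × Bool) × Bool)} (h : ¬ NoSingleton (base m)) :
    ∃ y ∈ m, axCount (base m) y.1.1 = 1 := by
  simp only [NoSingleton, not_forall, not_not] at h
  obtain ⟨a, ha⟩ := h
  obtain ⟨x, hx, hxa⟩ := List.countP_pos_iff.1 (show 0 < axCount (base m) a by rw [ha]; exact Nat.one_pos)
  obtain ⟨y, hy, rfl⟩ := List.mem_map.1 hx
  refine ⟨y, hy, ?_⟩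
  have : y.1.1 = a := by simpa using hxa
  rw [this, ha]

/-- ★★ THE SIGNED COUNT: `Σ_{valid marked words of length n} (−1)^{#marks} = #{self-avoiding words of length n without a singleton axis}`
— toggling the mark on the first singleton-axis letter is a sign-reversing involution off the no-singleton words.
[cite: MadrasSlade1993, Definition 1.1.1] -/
theorem sum_validWords_neg_one_pow (d n : ℕ) :
    ∑ m ∈ validWords d n, (-1 : ℤ) ^ nmarks m = ((nsWords d n).card : ℤ) := by
  classical
  rw [validWords, ← Finset.sum_filter_add_sum_filter_not _ (fun m => NoSingleton (base m))]
  -- the no-singleton part: every term is `1`, and `base` is a bijection onto `nsWords`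
  have h1 : ∑ m ∈ (Finset.filter ValidM (mwords d n)).filter (fun m => NoSingleton (base m)), (-1 : ℤ) ^ nmarks m =
      ((nsWords d n).card : ℤ) := by
    have hc : ∀ m ∈ (Finset.filter ValidM (mwords d n)).filter (fun m => NoSingleton (base m)), (-1 : ℤ) ^ nmarks m = 1 := by
      intro m hm
      rw [Finset.mem_filter, Finset.mem_filter] at hm
      rw [nmarks_eq_zero_of_noSingleton hm.1.2 hm.2, pow_zero]
    rw [Finset.sum_congr rfl hc, Finset.sum_const, nsmul_eq_mul, mul_one]
    congr 1
    refine Finset.card_bij (fun m _ => base m) (fun m hm => ?_) (fun m₁ hm₁ m₂ hm₂ h => ?_) (fun w hw => ?_)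
    · rw [Finset.mem_filter, Finset.mem_filter, mem_mwords] at hm
      rw [nsWords, Finset.mem_filter, mem_sawWords]
      exact ⟨⟨by rw [← hm.1.1]; simp [base], hm.1.2.1⟩, hm.2⟩
    · rw [Finset.mem_filter, Finset.mem_filter] at hm₁ hm₂
      rw [eq_map_base_of_nmarks_eq_zero (nmarks_eq_zero_of_noSingleton hm₁.1.2 hm₁.2),
        eq_map_base_of_nmarks_eq_zero (nmarks_eq_zero_of_noSingleton hm₂.1.2 hm₂.2), h]
    · rw [nsWords, Finset.mem_filter, mem_sawWords] at hw
      refine ⟨w.map fun x => (x, false), ?_, ?_⟩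
      · rw [Finset.mem_filter, Finset.mem_filter, mem_mwords]
        have hb : base (w.map fun x => (x, false)) = w := by simp [base, Function.comp_def]
        refine ⟨⟨by simp [hw.1.1], ?_, ?_⟩, by rw [hb]; exact hw.2⟩
        · rw [hb]; exact hw.1.2
        · intro y hy hy2
          obtain ⟨x, -, rfl⟩ := List.mem_map.1 hy
          simp at hy2
      · simp [base, Function.comp_def]
  -- the rest cancels under the toggling involution
  have h2 : ∑ m ∈ (Finset.filter ValidM (mwords d n)).filter (fun m => ¬ NoSingleton (base m)), (-1 : ℤ) ^ nmarks m = 0 := by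
    refine Finset.sum_involution (fun m _ => tog (base m) m) (fun m hm => ?_) (fun m hm _ => ?_) (fun m hm => ?_) (fun m hm => ?_)
    · rw [Finset.mem_filter] at hm
      rcases nmarks_tog (base m) m (exists_mem_singleton hm.2) with h | h <;> rw [h, pow_succ] <;> ring
    · rw [Finset.mem_filter] at hm
      intro heq
      have := congrArg nmarks heq
      rcases nmarks_tog (base m) m (exists_mem_singleton hm.2) with h | h <;> omega
    · rw [Finset.mem_filter, Finset.mem_filter, mem_mwords] at hm ⊢
      refine ⟨⟨by rw [length_tog, hm.1.1], validM_tog hm.1.2⟩, by rw [base_tog]; exact hm.2⟩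
    · show tog (base (tog (base m) m)) (tog (base m) m) = m
      rw [base_tog, tog_tog]
  rw [h1, h2, add_zero]

/-! ### §5 Relabelling: self-avoiding words over a `k`-set of axes of `ℤ^d` number `c_ℓ(ℤ^k)` -/

section relabel

variable (C : Finset (Fin d))

/-- The linear embedding `ℤ^{#C} → ℤ^d` onto the coordinates in `C`. [cite: MadrasSlade1993, §1.1] -/
def embC (v : Site C.card) : Site d := fun j => if h : j ∈ C then v ((C.orderIsoOfFin rfl).symm ⟨j, h⟩) else 0

/-- `embC` is additive. [cite: MadrasSlade1993, §1.1] -/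
theorem embC_add (v w : Site C.card) : embC C (v + w) = embC C v + embC C w := by
  funext j; simp only [embC, Pi.add_apply]; split_ifs <;> simp

/-- `embC 0 = 0`. [cite: MadrasSlade1993, §1.1] -/
theorem embC_zero : embC C (0 : Site C.card) = 0 := by
  funext j; simp only [embC, Pi.zero_apply]; split_ifs <;> simp

/-- `embC` is injective. [cite: MadrasSlade1993, §1.1] -/
theorem embC_injective : Function.Injective (embC C) := by
  intro v w h
  funext i
  have := congrFun h (C.orderIsoOfFin rfl i)
  simp only [embC, dif_pos (C.orderIsoOfFin rfl i).2, Subtype.coe_eta, OrderIso.symm_apply_apply] at this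
  exact this

/-- Relabel a letter over `Fin #C` as a letter of `ℤ^d` on an axis of `C`. [cite: MadrasSlade1993, §1.1] -/
def relab (x : Fin C.card × Bool) : Fin d × Bool := (((C.orderIsoOfFin rfl) x.1 : Fin d), x.2)

/-- The step of a relabelled letter is the embedded step. [cite: MadrasSlade1993, §1.1] -/
theorem stepVec_relab (x : Fin C.card × Bool) : stepVec (relab C x) = embC C (stepVec x) := by
  funext j
  rw [stepVec_apply', relab]
  unfold embC
  by_cases hj : j ∈ C
  · rw [dif_pos hj, stepVec_apply']
    have : (j = ((C.orderIsoOfFin rfl) x.1 : Fin d)) ↔ ((C.orderIsoOfFin rfl).symm ⟨j, hj⟩ = x.1) := by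
      constructor
      · intro h; apply (C.orderIsoOfFin rfl).injective; rw [OrderIso.apply_symm_apply]; exact Subtype.ext h
      · intro h; rw [← h, OrderIso.apply_symm_apply]
    simp only [this]
  · rw [dif_neg hj, if_neg]
    intro h; rw [h] at hj; exact hj ((C.orderIsoOfFin rfl) x.1).2

/-- The endpoint of a relabelled word is the embedded endpoint. [cite: MadrasSlade1993, §1.1] -/
theorem wEnd_map_relab (w : List (Fin C.card × Bool)) : wEnd (w.map (relab C)) = embC C (wEnd w) := by
  induction w with
  | nil => simp [embC_zero]
  | cons x w ih => rw [List.map_cons, wEnd_cons, wEnd_cons, ih, stepVec_relab, embC_add]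

/-- Relabelling preserves self-avoidance. [cite: MadrasSlade1993, §1.1] -/
theorem isSAW_map_relab_iff (w : List (Fin C.card × Bool)) : IsSAW (w.map (relab C)) ↔ IsSAW w := by
  rw [isSAW_iff_injOn, isSAW_iff_injOn, List.length_map]
  have ht : ∀ i, traj (w.map (relab C)) i = embC C (traj w i) := fun i => by
    rw [traj, traj, ← List.map_take, wEnd_map_relab]
  constructor
  · intro h i hi j hj hij; exact h hi hj (by rw [ht, ht, hij])
  · intro h i hi j hj hij; rw [ht, ht] at hij; exact h hi hj (embC_injective C hij)

/-- The letters of a relabelled word lie on axes of `C`. [cite: MadrasSlade1993, §1.1] -/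
theorem relab_fst_mem (x : Fin C.card × Bool) : (relab C x).1 ∈ C := ((C.orderIsoOfFin rfl) x.1).2

/-- ★ Self-avoiding words of length `ℓ` all of whose letters lie on axes of `C` number `c_ℓ(ℤ^{#C})`. [cite: MadrasSlade1993, §1.1] -/
theorem card_sawWords_filter_axes (ℓ : ℕ) :
    ((sawWords d ℓ).filter fun g => ∀ x ∈ g, x.1 ∈ C).card = count C.card ℓ := by
  rw [← card_sawWords C.card ℓ]
  symm
  refine Finset.card_bij (fun w _ => w.map (relab C)) (fun w hw => ?_) (fun w₁ _ w₂ _ h => ?_) (fun g hg => ?_)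
  · rw [mem_sawWords] at hw
    rw [Finset.mem_filter, mem_sawWords, List.length_map, isSAW_map_relab_iff]
    exact ⟨hw, fun x hx => by obtain ⟨y, -, rfl⟩ := List.mem_map.1 hx; exact relab_fst_mem C y⟩
  · exact List.map_injective_iff.2 (fun x y hxy => by
      obtain ⟨x1, x2⟩ := x; obtain ⟨y1, y2⟩ := y
      simp only [relab, Prod.mk.injEq] at hxy
      rw [Prod.mk.injEq]
      exact ⟨(C.orderIsoOfFin rfl).injective (Subtype.ext hxy.1), hxy.2⟩) h
  · rw [Finset.mem_filter, mem_sawWords] at hg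
    set w : List (Fin C.card × Bool) := g.attach.map fun x => ((C.orderIsoOfFin rfl).symm ⟨x.1.1, hg.2 x.1 x.2⟩, x.1.2) with hw
    have hmap : w.map (relab C) = g := by
      rw [hw, List.map_map]
      conv_rhs => rw [← List.attach_map_subtype_val g]
      refine List.map_congr_left fun x _ => ?_
      simp only [Function.comp_apply, relab, OrderIso.apply_symm_apply]
    refine ⟨w, ?_, hmap⟩
    rw [mem_sawWords]
    refine ⟨by rw [hw]; simp [hg.1.1], ?_⟩
    rw [← isSAW_map_relab_iff C, hmap]
    exact hg.1.2

end relabel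

/-! ### §6 Counting the valid marked words with `r` marks: choose the marked letters, then the blocks over the other axes -/

section counting

variable (d)

/-- The admissible mark assignments: `r` letters on pairwise distinct axes. [cite: MadrasSlade1993, Definition 1.1.1] -/
def markFns (r : ℕ) : Finset (Fin r → Fin d × Bool) := Finset.univ.filter fun ε => Function.Injective (Prod.fst ∘ ε)

/-- The blocks allowed after a mark assignment `ε`: self-avoiding words of length `ℓ` avoiding the marked axes. [cite: MadrasSlade1993, Definition 1.1.1] -/
def blockSet {r : ℕ} (ε : Fin r → Fin d × Bool) (ℓ : ℕ) : Finset (List (Fin d × Bool)) :=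
  (sawWords d ℓ).filter fun g => ∀ i, axCount g (ε i).1 = 0

/-- The glued marked word of a mark assignment and a block family. [cite: MadrasSlade1993, Definition 1.1.1] -/
def assemble {r : ℕ} (ε : Fin r → Fin d × Bool) (γ : Fin (r + 1) → List (Fin d × Bool)) : List ((Fin d × Bool) × Bool) :=
  glueR (γ 0) (List.ofFn fun i : Fin r => (ε i, γ i.succ))

variable {d}

/-- ★ `#markFns = 2^r · d(d−1)⋯(d−r+1)`. [cite: MadrasSlade1993, Definition 1.1.1] -/
theorem card_markFns (r : ℕ) : (markFns d r).card = 2 ^ r * d.descFactorial r := by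
  classical
  have h1 : (markFns d r).card =
      (((Finset.univ : Finset (Fin r → Fin d)).filter Function.Injective) ×ˢ (Finset.univ : Finset (Fin r → Bool))).card := by
    rw [markFns]
    refine Finset.card_bij (fun ε _ => (Prod.fst ∘ ε, Prod.snd ∘ ε)) (fun ε hε => ?_) (fun ε₁ _ ε₂ _ h => ?_) (fun p hp => ?_)
    · rw [Finset.mem_filter] at hε
      exact Finset.mem_product.2 ⟨Finset.mem_filter.2 ⟨Finset.mem_univ _, hε.2⟩, Finset.mem_univ _⟩
    · simp only [Prod.mk.injEq] at h
      funext i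
      exact Prod.ext (congrFun h.1 i) (congrFun h.2 i)
    · refine ⟨fun i => (p.1 i, p.2 i), Finset.mem_filter.2 ⟨Finset.mem_univ _, ?_⟩, ?_⟩
      · have := (Finset.mem_filter.1 (Finset.mem_product.1 hp).1).2; exact this
      · rfl
  have h2 : ((Finset.univ : Finset (Fin r → Fin d)).filter Function.Injective).card = d.descFactorial r := by
    rw [← Fintype.card_subtype, Fintype.card_congr (Equiv.subtypeInjectiveEquivEmbedding (Fin r) (Fin d)),
      Fintype.card_embedding_eq]
    simp
  rw [h1, Finset.card_product, h2, Finset.card_univ, Fintype.card_fun, Fintype.card_bool, Fintype.card_fin, mul_comm]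

/-- ★ `#blockSet ε ℓ = c_ℓ(ℤ^{d−r})` for an admissible mark assignment. [cite: MadrasSlade1993, §1.1] -/
theorem card_blockSet {r : ℕ} {ε : Fin r → Fin d × Bool} (hε : ε ∈ markFns d r) (ℓ : ℕ) :
    (blockSet d ε ℓ).card = count (d - r) ℓ := by
  classical
  rw [markFns, Finset.mem_filter] at hε
  set C : Finset (Fin d) := Finset.univ \ Finset.univ.image (Prod.fst ∘ ε) with hC
  have hcard : C.card = d - r := by
    rw [hC, Finset.card_univ_sdiff, Finset.card_image_of_injective _ hε.2]
    simp
  rw [← hcard, ← card_sawWords_filter_axes C ℓ, blockSet]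
  congr 1
  refine Finset.filter_congr fun g _ => ?_
  simp only [axCount_eq_zero_iff, hC, Finset.mem_sdiff, Finset.mem_univ, true_and, Finset.mem_image, Function.comp_apply,
    not_exists]
  exact ⟨fun h x hx i hi => h i x hx hi.symm, fun h i x hx hxi => h x hx i hxi.symm⟩

/-- `split ∘ assemble`. [cite: MadrasSlade1993, Definition 1.1.1] -/
theorem split_assemble {r : ℕ} (ε : Fin r → Fin d × Bool) (γ : Fin (r + 1) → List (Fin d × Bool)) :
    split (assemble d ε γ) = (γ 0, List.ofFn fun i : Fin r => (ε i, γ i.succ)) := split_glueR _ _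

/-- `assemble` is injective in the pair (marks, blocks). [cite: MadrasSlade1993, Definition 1.1.1] -/
theorem assemble_injective {r : ℕ} {ε ε' : Fin r → Fin d × Bool} {γ γ' : Fin (r + 1) → List (Fin d × Bool)}
    (h : assemble d ε γ = assemble d ε' γ') : ε = ε' ∧ γ = γ' := by
  have hs := congrArg split h
  rw [split_assemble, split_assemble, Prod.mk.injEq] at hs
  have hl := List.ofFn_injective hs.2
  refine ⟨funext fun i => (Prod.mk.inj (congrFun hl i)).1, funext fun j => Fin.cases hs.1 (fun i => (Prod.mk.inj (congrFun hl i)).2) j⟩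

/-- The length of an assembled word: the block lengths plus the number of marks. [cite: MadrasSlade1993, Definition 1.1.1] -/
theorem length_assemble {r : ℕ} (ε : Fin r → Fin d × Bool) (γ : Fin (r + 1) → List (Fin d × Bool)) :
    (assemble d ε γ).length = (∑ j, (γ j).length) + r := by
  rw [assemble, length_glueR, List.map_ofFn, List.sum_ofFn, Fin.sum_univ_succ]
  simp only [Function.comp_apply, Finset.sum_add_distrib, Finset.sum_const, Finset.card_univ, Fintype.card_fin,
    smul_eq_mul, mul_one]
  ring

/-- An assembled word carries `r` marks. [cite: MadrasSlade1993, Definition 1.1.1] -/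
theorem nmarks_assemble {r : ℕ} (ε : Fin r → Fin d × Bool) (γ : Fin (r + 1) → List (Fin d × Bool)) :
    nmarks (assemble d ε γ) = r := by
  rw [assemble, nmarks_glueR, List.length_ofFn]

/-- ★ An assembled word is VALID iff every block is self-avoiding and avoids the marked axes, which are pairwise distinct.
[cite: MadrasSlade1993, Definition 1.1.1] -/
theorem validM_assemble_iff {r : ℕ} (ε : Fin r → Fin d × Bool) (γ : Fin (r + 1) → List (Fin d × Bool)) :
    ValidM (assemble d ε γ) ↔ (∀ j, IsSAW (γ j)) ∧ Function.Injective (Prod.fst ∘ ε) ∧ ∀ i j, axCount (γ j) (ε i).1 = 0 := by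
  rw [assemble, validM_glueR_iff, AdmF]
  simp only [List.forall_mem_ofFn_iff, List.map_ofFn, List.nodup_ofFn, Function.comp_def]
  constructor
  · rintro ⟨⟨h0, hS⟩, hinj, hax⟩
    refine ⟨fun j => Fin.cases h0 (fun i => hS i) j, hinj, fun i j => Fin.cases (hax i).1 (fun i' => (hax i).2 i') j⟩
  · rintro ⟨hsaw, hinj, hax⟩
    exact ⟨⟨hsaw 0, fun i => hsaw i.succ⟩, hinj, fun i => ⟨hax i 0, fun i' => hax i i'.succ⟩⟩

/-- ★★★ THE COUNT OF VALID MARKED WORDS WITH `r` MARKS: choosing the `r` marked letters on distinct axes (`2^r · d(d−1)⋯(d−r+1)` ways)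
and then the `r + 1` blocks — arbitrary self-avoiding words over the remaining `d − r` axes with prescribed total length `s` — gives
`#{valid marked words of length s + r with r marks} = 2^r d^{(r)} Σ_{ℓ₀+⋯+ℓ_r = s} Π_j c_{ℓ_j}(ℤ^{d−r})`. [cite: MadrasSlade1993, §1.1] -/
theorem card_validWords_filter_nmarks (d s r : ℕ) :
    ((validWords d (s + r)).filter fun m => nmarks m = r).card =
      2 ^ r * d.descFactorial r * ∑ ℓ ∈ Finset.Nat.antidiagonalTuple (r + 1) s, ∏ j, count (d - r) (ℓ j) := by
  classical
  set Dom := ((Finset.Nat.antidiagonalTuple (r + 1) s) ×ˢ markFns d r).sigma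
      (fun p => Fintype.piFinset fun j => blockSet d p.2 (p.1 j)) with hDom
  have hcardDom : Dom.card = 2 ^ r * d.descFactorial r * ∑ ℓ ∈ Finset.Nat.antidiagonalTuple (r + 1) s, ∏ j, count (d - r) (ℓ j) := by
    rw [hDom, Finset.card_sigma, Finset.sum_product]
    have key : ∀ ℓ ∈ Finset.Nat.antidiagonalTuple (r + 1) s,
        ∑ ε ∈ markFns d r, (Fintype.piFinset fun j => blockSet d (ℓ, ε).2 ((ℓ, ε).1 j)).card =
          (2 ^ r * d.descFactorial r) * ∏ j, count (d - r) (ℓ j) := by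
      intro ℓ _
      have inner : ∀ ε ∈ markFns d r, (Fintype.piFinset fun j => blockSet d (ℓ, ε).2 ((ℓ, ε).1 j)).card = ∏ j, count (d - r) (ℓ j) := by
        intro ε hε
        rw [Fintype.card_piFinset]
        exact Finset.prod_congr rfl fun j _ => card_blockSet hε (ℓ j)
      rw [Finset.sum_congr rfl inner, Finset.sum_const, card_markFns, smul_eq_mul]
    rw [Finset.sum_congr rfl key, ← Finset.mul_sum]
  rw [← hcardDom]
  symm
  refine Finset.card_bij (fun x _ => assemble d x.1.2 x.2) (fun x hx => ?_) (fun x hx y hy h => ?_) (fun m hm => ?_)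
  · -- the assembled word is a valid marked word of the right length with `r` marks
    obtain ⟨⟨ℓ, ε⟩, γ⟩ := x
    rw [hDom, Finset.mem_sigma, Finset.mem_product, Fintype.mem_piFinset] at hx
    obtain ⟨⟨hℓ, hε⟩, hγ⟩ := hx
    rw [Finset.Nat.mem_antidiagonalTuple] at hℓ
    have hγ' : ∀ j, (γ j).length = ℓ j ∧ IsSAW (γ j) ∧ ∀ i, axCount (γ j) (ε i).1 = 0 := fun j => by
      have := hγ j
      rw [blockSet, Finset.mem_filter, mem_sawWords] at this
      exact ⟨this.1.1, this.1.2, this.2⟩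
    rw [Finset.mem_filter, validWords, Finset.mem_filter, mem_mwords, length_assemble, nmarks_assemble, validM_assemble_iff]
    refine ⟨⟨?_, fun j => (hγ' j).2.1, (Finset.mem_filter.1 hε).2, fun i j => (hγ' j).2.2 i⟩, rfl⟩
    rw [← hℓ, Finset.sum_congr rfl fun j _ => (hγ' j).1]
  · -- injectivity
    obtain ⟨⟨ℓ, ε⟩, γ⟩ := x
    obtain ⟨⟨ℓ', ε'⟩, γ'⟩ := y
    obtain ⟨hε, hγ⟩ := assemble_injective h
    subst hε
    subst hγ
    rw [hDom, Finset.mem_sigma, Finset.mem_product, Fintype.mem_piFinset] at hx hy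
    dsimp only at hx hy
    have : ℓ = ℓ' := by
      funext j
      have h1 := hx.2 j
      have h2 := hy.2 j
      rw [blockSet, Finset.mem_filter, mem_sawWords] at h1 h2
      rw [← h1.1.1, ← h2.1.1]
    subst this
    rfl
  · -- surjectivity: split the valid word at its marks
    rw [Finset.mem_filter, validWords, Finset.mem_filter, mem_mwords] at hm
    obtain ⟨⟨hlen, hV⟩, hr⟩ := hm
    have hm : glueR (split m).1 (split m).2 = m := glueR_split m
    have hrl : (split m).2.length = r := by rw [← hr, ← nmarks_glueR (split m).1 (split m).2, hm]
    subst hrl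
    set rest := (split m).2 with hrest
    set g₀ := (split m).1 with hg₀
    let ε : Fin rest.length → Fin d × Bool := fun i => (rest.get i).1
    let γ : Fin (rest.length + 1) → List (Fin d × Bool) := Fin.cases g₀ fun i => (rest.get i).2
    have hofFn : List.ofFn (fun i => (ε i, γ i.succ)) = rest := by
      simp [ε, γ]
    have hass : assemble d ε γ = m := by rw [assemble, hofFn]; exact hm
    have hV' := (validM_assemble_iff ε γ).1 (hass ▸ hV)
    obtain ⟨hsaw, hinj, hax⟩ := hV'
    refine ⟨⟨⟨fun j => (γ j).length, ε⟩, γ⟩, ?_, hass⟩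
    rw [hDom, Finset.mem_sigma, Finset.mem_product, Fintype.mem_piFinset, Finset.Nat.mem_antidiagonalTuple]
    refine ⟨⟨?_, Finset.mem_filter.2 ⟨Finset.mem_univ _, hinj⟩⟩, fun j =>
      Finset.mem_filter.2 ⟨mem_sawWords.2 ⟨rfl, hsaw j⟩, fun i => hax i j⟩⟩
    show ∑ j, (γ j).length = s
    have := length_assemble ε γ
    rw [hass, hlen] at this
    omega

end counting


/-! ### §7 THE SINGLETON-AXIS RENEWAL IDENTITY -/

/-- The number of marks is at most the length. [cite: MadrasSlade1993, Definition 1.1.1] -/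
theorem nmarks_le_length (m : List ((Fin d × Bool) × Bool)) : nmarks m ≤ m.length := List.countP_le_length

/-- The block sum `S_r(n) = Σ_{ℓ₀+⋯+ℓ_r = n − r} Π_j c_{ℓ_j}(ℤ^{d−r})` of the identity (tool notion). [cite: MadrasSlade1993, §1.1] -/
noncomputable def blockSum (d n r : ℕ) : ℕ := ∑ ℓ ∈ Finset.Nat.antidiagonalTuple (r + 1) (n - r), ∏ j, count (d - r) (ℓ j)

/-- `S_0(n) = c_n(ℤ^d)`. [cite: MadrasSlade1993, §1.1] -/
theorem blockSum_zero (d n : ℕ) : blockSum d n 0 = count d n := by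
  rw [blockSum, Nat.sub_zero, Nat.sub_zero]
  rw [show Finset.Nat.antidiagonalTuple (0 + 1) n = {![n]} from Finset.Nat.antidiagonalTuple_one n, Finset.sum_singleton,
    Fin.prod_univ_one]
  rfl

/-- ★★★ **THE SINGLETON-AXIS RENEWAL IDENTITY** (lane «pcv-sawmu», a-p3 g23): for every dimension `d` and length `n`,
`#{n-step SAWs of ℤ^d with no axis used exactly once} = Σ_{r=0}^{n} (−1)^r · 2^r · d(d−1)⋯(d−r+1) · Σ_{ℓ₀+⋯+ℓ_r = n−r} Π_j c_{ℓ_j}(ℤ^{d−r})`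
— an axis used exactly once splits self-avoidance (`isSAW_append_cons_iff`), so marking singleton steps with signs `−1` and gluing
arbitrary self-avoiding blocks over the unmarked axes telescopes to the no-singleton words. The `r = 0` term is `c_n(ℤ^d)` (`blockSum_zero`).
[cite: MadrasSlade1993, §1.1] [cite: ClisbyLiangSlade2007, §3.3 eq. (31) (p. 10984: c_n for n ≤ 2k in all dimensions from d ≤ k)] -/
theorem card_nsWords_eq_sum (d n : ℕ) :
    ((nsWords d n).card : ℤ) = ∑ r ∈ Finset.range (n + 1), (-1 : ℤ) ^ r * (2 ^ r * d.descFactorial r * blockSum d n r : ℕ) := by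
  classical
  rw [← sum_validWords_neg_one_pow,
    ← Finset.sum_fiberwise_of_maps_to (s := validWords d n) (t := Finset.range (n + 1)) (g := nmarks) (fun m hm => by
      rw [validWords, Finset.mem_filter, mem_mwords] at hm
      exact Finset.mem_range.2 (Nat.lt_succ_of_le (hm.1 ▸ nmarks_le_length m)))]
  refine Finset.sum_congr rfl fun r hr => ?_
  have hrn : r ≤ n := Nat.le_of_lt_succ (Finset.mem_range.1 hr)
  rw [Finset.sum_congr rfl (fun m hm => by rw [(Finset.mem_filter.1 hm).2] : ∀ m ∈ (validWords d n).filter (fun m => nmarks m = r),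
    (-1 : ℤ) ^ nmarks m = (-1) ^ r), Finset.sum_const, nsmul_eq_mul, mul_comm]
  congr 1
  have h := card_validWords_filter_nmarks d (n - r) r
  rw [Nat.sub_add_cancel hrn] at h
  rw [h, blockSum]

/-- ★★★ **`c_n(ℤ^d)` FROM SHORTER WALKS AND THE NO-SINGLETON WORDS** — the identity solved for its `r = 0` term:
`c_n(ℤ^d) = A_n(d) + Σ_{r=1}^{n} (−1)^{r+1} 2^r d^{(r)} Σ_{ℓ₀+⋯+ℓ_r = n−r} Π_j c_{ℓ_j}(ℤ^{d−r})`, `A_n(d) = #nsWords d n`.  Since a word without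
singleton axes uses at most `⌊n/2⌋` axes, this gives `c_n(ℤ^d)` in EVERY dimension from the `c_ℓ`, `ℓ < n`, and one census over `≤ n/2` axes.
[cite: MadrasSlade1993, §1.1] [cite: ClisbyLiangSlade2007, §3.3 eq. (31)] -/
theorem count_eq_card_nsWords_add_sum (d n : ℕ) :
    (count d n : ℤ) = (nsWords d n).card +
      ∑ r ∈ Finset.Ico 1 (n + 1), (-1 : ℤ) ^ (r + 1) * (2 ^ r * d.descFactorial r * blockSum d n r : ℕ) := by
  have h := card_nsWords_eq_sum d n
  rw [Finset.range_eq_Ico, Finset.sum_eq_sum_Ico_succ_bot (Nat.succ_pos n), pow_zero, one_mul, pow_zero,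
    Nat.descFactorial_zero, one_mul, one_mul, blockSum_zero] at h
  have hneg : ∑ r ∈ Finset.Ico 1 (n + 1), (-1 : ℤ) ^ (r + 1) * (2 ^ r * d.descFactorial r * blockSum d n r : ℕ) =
      -∑ r ∈ Finset.Ico 1 (n + 1), (-1 : ℤ) ^ r * (2 ^ r * d.descFactorial r * blockSum d n r : ℕ) := by
    rw [← Finset.sum_neg_distrib]
    exact Finset.sum_congr rfl fun r _ => by ring
  rw [hneg, h]
  ring

end Word

end Literature.Probability.RandomPlanarGeometry.SAW.Zd
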